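import Literature.IUT.LogThetaLattice.HolomorphicLogShellVolume
import HarnessLib

/-!
# [AbsTopIII] Cor 5.10 (iv)(d): the schema `MonoAnalyticLogShellVolume L t` (FACT-LIST F-0162) has a REFUTABLE universal closure

S. Mochizuki, *Topics in absolute anabelian geometry III*, J. Math. Sci. Univ. Tokyo 22 (2015)
[MochizukiAbsTopIII2015], Cor 5.10 (iv)(d) p. 148 with Prop 5.8 (i), (iii) pp. 139–140 (manuscript pages).

Negative knowledge recorded next to `Literature/AnabelianGeometry/AbsoluteAnabelian/LogShellVolumes.lean`
(abc-iut-L4-t3; FACT-LIST row **F-0162**, class `preparatory`, cone-inside, status `fact-open`), PROOF-ONLY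
(no definitions, no instances). The typed named fact

  `MonoAnalyticLogShellVolume (L : PadicLogOnUnits K) (t : MLFType) : Prop`

binds, in its hypotheses, the residue characteristic `t.p`, the residue degree `t.f` (`[𝒪 : ϖ𝒪] = p^f`) and
the ramification index `t.e` (`‖p*‖ = ‖ϖ‖^{e·c}`) of `K`, but NOT the fourth printed invariant
`t.m` ("`p^m` = the order of the group of `p`-power roots of unity of `k`", Prop 5.8 (i) p. 139), while its
conclusion `μ_k^log(ℐ_k) = t.logShellLogVolume = (f·e·c − f − m)·log p` depends on `t.m`. abc-iut-L6-d2's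
`monoAnalyticLogShellVolume_ofUnitLog_iff` (HolomorphicLogShellVolume.lean) already characterises the row
at the standard model `L = PadicLogOnUnits.ofUnitLog p K` of the genuine `p`-adic logarithm:
it HOLDS iff `t.m = torsionPExp p K`. This file turns that characterisation into the kernel objects the
FACT-LIST fold consumes (finding «F18», abc-iut-L6-d2 2026-08-25T19:58:25Z; abc-iut-w4-d001 23:35:42Z):

* `not_monoAnalyticLogShellVolume_ofUnitLog_of_ne` — for every complete nonarchimedean `K/ℚ_p` and every
  numerical type `t = (p, f_K, e_K, m)` with `m ≠ m_K` the row is FALSE at the standard model;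
* `not_forall_type_monoAnalyticLogShellVolume_ofUnitLog` — hence `∀ t, MonoAnalyticLogShellVolume (ofUnitLog p K) t`
  is false for EVERY such `K` (witness `m := m_K + 1`), although the genuine instance `t = type(K)` holds
  (`monoAnalyticLogShellVolume_ofUnitLog_type`, = abc-iut-L6-d2's `holMonoVolumeCompatible_ofUnitLog`);
* `not_forall_monoAnalyticLogShellVolume` — the fully quantified universal closure over
  `(K, L, t)` is refutable (witness `K = ℚ_[2]`, `L = ofUnitLog 2 ℚ_[2]`).

So F-0162 is admissible ONLY in its instance form `t = (p, f_K, e_K, m_K)`, which is exactly the REPAIRED row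
F-0163 `MonoAnalyticLogShellVolumeOfType` (PROVED at the standard model by abc-iut-L4-t15,
`monoAnalyticLogShellVolumeOfType_ofUnitLog`, p408886). Classical local-field bookkeeping; nothing here
bears on the disputed [IUTchIII] Cor. 3.12 or takes a side; refuted is never a fact (FACT-LIST rule R5).
-/

noncomputable section

namespace Literature.IUT.LogThetaLattice

open Literature.AnabelianGeometry.AbsoluteAnabelian
open Literature.IUT.LogVolume (absRamificationIdx residueDegree torsionPExp absRamificationIdx_pos
  residueDegree_pos)

variable (p : ℕ) [Fact p.Prime]
variable (K : Type*) [NontriviallyNormedField K] [NormedAlgebra ℚ_[p] K] [IsUltrametricDist K]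
  [ProperSpace K] [MeasurableSpace K] [BorelSpace K]

/-- **F-0162 at the standard model, wrong `m`:** for the numerical type `(p, f_K, e_K, m)` with
`m ≠ m_K := torsionPExp p K` the named fact `MonoAnalyticLogShellVolume (ofUnitLog p K) t` is FALSE
(its hypotheses are met by any norm uniformizer, its conclusion is off by `(m_K − m)·log p ≠ 0`).
[cite: MochizukiAbsTopIII2015, Cor 5.10 (iv)(d) p. 148] -/
theorem not_monoAnalyticLogShellVolume_ofUnitLog_of_ne (m : ℕ) (hm : m ≠ torsionPExp p K) :
    ¬ MonoAnalyticLogShellVolume (PadicLogOnUnits.ofUnitLog p K)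
      ⟨p, Fact.out, residueDegree p K, residueDegree_pos p K, absRamificationIdx p K,
        absRamificationIdx_pos p K, m⟩ :=
  fun h => hm ((monoAnalyticLogShellVolume_ofUnitLog_iff p K _ rfl rfl rfl).mp h)

/-- **F-0162 at the standard model, genuine `m`:** for the numerical type OF `K`, `t = (p, f_K, e_K, m_K)`,
the named fact HOLDS (this is the instance form = the repaired row F-0163 / abc-iut-L6-d2's
`holMonoVolumeCompatible_ofUnitLog`). [cite: MochizukiAbsTopIII2015, Cor 5.10 (iv)(d) p. 148] -/
theorem monoAnalyticLogShellVolume_ofUnitLog_type :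
    MonoAnalyticLogShellVolume (PadicLogOnUnits.ofUnitLog p K)
      ⟨p, Fact.out, residueDegree p K, residueDegree_pos p K, absRamificationIdx p K,
        absRamificationIdx_pos p K, torsionPExp p K⟩ :=
  (monoAnalyticLogShellVolume_ofUnitLog_iff p K _ rfl rfl rfl).mpr rfl

/-- **The `t`-closure of F-0162 is false at EVERY standard model:** `¬ ∀ t, MonoAnalyticLogShellVolume (ofUnitLog p K) t`
(witness `t = (p, f_K, e_K, m_K + 1)`). [cite: MochizukiAbsTopIII2015, Cor 5.10 (iv)(d) p. 148] -/
theorem not_forall_type_monoAnalyticLogShellVolume_ofUnitLog :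
    ¬ ∀ t : MLFType, MonoAnalyticLogShellVolume (PadicLogOnUnits.ofUnitLog p K) t :=
  fun h => not_monoAnalyticLogShellVolume_ofUnitLog_of_ne p K (torsionPExp p K + 1) (Nat.succ_ne_self _)
    (h _)

/-- hence the row is SATISFIABLE and REFUTABLE in `t` at one and the same `(K, L)`: it is a schema whose
instance form only is admissible. [cite: MochizukiAbsTopIII2015, Cor 5.10 (iv)(d) p. 148] -/
theorem exists_monoAnalyticLogShellVolume_ofUnitLog_and_exists_not :
    (∃ t : MLFType, MonoAnalyticLogShellVolume (PadicLogOnUnits.ofUnitLog p K) t) ∧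
      ∃ t : MLFType, ¬ MonoAnalyticLogShellVolume (PadicLogOnUnits.ofUnitLog p K) t :=
  ⟨⟨_, monoAnalyticLogShellVolume_ofUnitLog_type p K⟩,
    ⟨_, not_monoAnalyticLogShellVolume_ofUnitLog_of_ne p K (torsionPExp p K + 1) (Nat.succ_ne_self _)⟩⟩

/-- **FACT-LIST F-0162, universal closure REFUTED:** it is not the case that `MonoAnalyticLogShellVolume L t`
holds for every proper ultrametric normed field `K`, every `p`-adic-logarithm structure `L` on it and every
numerical type `t` — witness `K = ℚ_[2]` with its Borel σ-algebra, `L = ofUnitLog 2 ℚ_[2]`,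
`t = (2, f, e, m + 1)`. [cite: MochizukiAbsTopIII2015, Cor 5.10 (iv)(d) p. 148] -/
theorem not_forall_monoAnalyticLogShellVolume :
    ¬ ∀ (F : Type) [NontriviallyNormedField F] [IsUltrametricDist F] [ProperSpace F] [MeasurableSpace F]
        [BorelSpace F] (L : PadicLogOnUnits F) (t : MLFType), MonoAnalyticLogShellVolume L t := by
  intro h
  haveI : Fact (Nat.Prime 2) := ⟨Nat.prime_two⟩
  borelize ℚ_[2]
  exact not_forall_type_monoAnalyticLogShellVolume_ofUnitLog 2 ℚ_[2] (h ℚ_[2] _)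

end Literature.IUT.LogThetaLattice

end
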